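import Summits.CriticalPhenomena.PercolationContinuityZ3.Theorems.PercNearOneGluingNoHeavyLowerTailSahiDeepCoreEGC
import Mathlib.Tactic.Linarith
import Mathlib.Tactic.Ring
import HarnessLib

/-!
# `NoHeavyLowerTail` (crux stmt-CriticalPhenomena-4575), master-family line P1: Gladkov's TRANSITION CELLS at a coordinate for a sandwiched
# triple — the bookkeeping identities

Support file (seat `prim-masterthm-p1`, gen 10; `--supports stmt-CriticalPhenomena-4575`).  No definition, no `sorry`, standard axioms.
Memo `run/shared/lean/prim/prim-masterthm/FROM-prim-masterthm-p1-g10-DEEP-CORE.md` §5; used by `…SahiDeepCoreStatic` (transition form of `egcBracket`).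

SETTING.  Sandwiched increasing triple `(A, B, N)`; cells `P = A∖B`, `Q = B∖A`, `K = A∩B∩N`, `Dₙ = (A∩B)∖N`, `O = (A∪B)ᶜ`; coordinate `e`,
sections `X⁰ = X^{e←0}`, `X¹ = X^{e←1}`.  Because `K`, `K∪P = A∩N`, `K∪Q = B∩N`, `K∪Dₙ = A∩B` are increasing and `O` is decreasing, raising `e`
can only move a configuration `O → anything`, `petal → same petal or K`, `K → K` [cite: Gladkov2024StrongFKG, proof of Thm. 2.1 (the cells
`A₀, B₀, C_i⁺, C_i°, C_i⁻, D`)].  With the TRANSITION MASSES `cp_X = μ(X⁰∩K¹)`, `cm_X = μ(O⁰∩X¹)`, `cs_X = μ(X⁰∩X¹)`, `d = μ(O⁰∩K¹)`: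
`μX⁰ = cs_X + cp_X` (`petal_section_false`, `dpetal_section_false`), `μX¹ = cs_X + cm_X` (`petal_section_true`, `dpetal_section_true`),
`μK¹ = μK⁰ + d + Σ cp` (`core_section_true`), `μO⁰ = μO¹ + d + Σ cm` (`outside_section_false`). [this work]
-/

noncomputable section

open scoped Classical

namespace Summit.CriticalPhenomena.PercolationContinuityZ3.Theorems

namespace SahiDeepCore

open Finset Function
open Literature.Combinatorics.Sahi2008
open Literature.Probability.Percolation.DecisionTree (ind ind_of_mem ind_of_not_mem ind_nonneg)

variable {ι : Type} [Fintype ι]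

local notation3 (prettyPrint := false) "m⟦" p ", " X "⟧" => ex (bernoulliWeight p) (ind X)

/-! ### Transition bookkeeping at a coordinate -/

section Bookkeeping

variable (p : ι → unitInterval) (e : ι) {A B N : Set (Set ι)}

omit [Fintype ι] in
/-- Raising a coordinate keeps a configuration of an increasing event inside it. [folklore] -/
private theorem secAt_false_sub_true {X : Set (Set ι)} (hX : IsUpperSet X) : secAt e false X ⊆ secAt e true X :=
  secAt_false_subset_true hX e

omit [Fintype ι] in
/-- Lowering a coordinate keeps a configuration outside an increasing event outside it. [folklore] -/
private theorem secAt_true_compl_sub {X : Set (Set ι)} (hX : IsUpperSet X) : secAt e true Xᶜ ⊆ secAt e false Xᶜ := by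
  intro ω hω
  have h1 : ω ∉ secAt e true X := hω
  show ω ∉ secAt e false X
  exact fun h0 => h1 (secAt_false_subset_true hX e h0)

/-- **Petal bookkeeping, level 0**: a level-`0` petal configuration moves, when `e` is raised, into the same petal or into the core:
`μ(X⁰) = μ(X⁰ ∩ X¹) + μ(X⁰ ∩ K¹)` for the petal `X = A ∖ B` of a sandwiched increasing triple (the others by symmetry / the `Dₙ` version). [this work] -/
theorem petal_section_false (hA : IsUpperSet A) (hN : IsUpperSet N) (hAB : A \ B ⊆ N) :
    m⟦p, secAt e false (A \ B)⟧ =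
      m⟦p, secAt e false (A \ B) ∩ secAt e true (A \ B)⟧ + m⟦p, secAt e false (A \ B) ∩ secAt e true (A ∩ B ∩ N)⟧ := by
  have hAN : IsUpperSet (A ∩ N) := hA.inter hN
  have e1 : ind (secAt e false (A \ B)) =
      ind (secAt e false (A \ B) ∩ secAt e true (A \ B)) + ind (secAt e false (A \ B) ∩ secAt e true (A ∩ B ∩ N)) := by
    funext ω
    simp only [Pi.add_apply]
    by_cases h0 : ω ∈ secAt e false (A \ B)
    · rw [ind_of_mem h0]
      -- `forceAt e false ω ∈ A ∖ B ⊆ A ∩ N`, hence `forceAt e true ω ∈ A ∩ N`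
      have hAN0 : ω ∈ secAt e false (A ∩ N) := by
        rw [mem_secAt] at h0 ⊢; exact ⟨h0.1, hAB h0⟩
      have hAN1 : ω ∈ secAt e true (A ∩ N) := secAt_false_sub_true e hAN hAN0
      rw [mem_secAt] at hAN1
      by_cases hB1 : forceAt e true ω ∈ B
      · have hK : ω ∈ secAt e true (A ∩ B ∩ N) := by rw [mem_secAt]; exact ⟨⟨hAN1.1, hB1⟩, hAN1.2⟩
        have hP : ω ∉ secAt e true (A \ B) := by rw [mem_secAt]; exact fun h => h.2 hB1
        rw [ind_of_not_mem (show ω ∉ secAt e false (A \ B) ∩ secAt e true (A \ B) from fun h => hP h.2),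
          ind_of_mem (show ω ∈ secAt e false (A \ B) ∩ secAt e true (A ∩ B ∩ N) from ⟨h0, hK⟩)]; norm_num
      · have hP : ω ∈ secAt e true (A \ B) := by rw [mem_secAt]; exact ⟨hAN1.1, hB1⟩
        have hK : ω ∉ secAt e true (A ∩ B ∩ N) := by rw [mem_secAt]; exact fun h => hB1 h.1.2
        rw [ind_of_mem (show ω ∈ secAt e false (A \ B) ∩ secAt e true (A \ B) from ⟨h0, hP⟩),
          ind_of_not_mem (show ω ∉ secAt e false (A \ B) ∩ secAt e true (A ∩ B ∩ N) from fun h => hK h.2)]; norm_num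
    · rw [ind_of_not_mem h0, ind_of_not_mem (show ω ∉ secAt e false (A \ B) ∩ secAt e true (A \ B) from fun h => h0 h.1),
        ind_of_not_mem (show ω ∉ secAt e false (A \ B) ∩ secAt e true (A ∩ B ∩ N) from fun h => h0 h.1)]; norm_num
  have h := congrArg (ex (bernoulliWeight p)) e1
  rwa [ex_add] at h

/-- **Petal bookkeeping, level 1**: a level-`1` petal configuration comes, when `e` is lowered, from the same petal or from outside:
`μ(X¹) = μ(X⁰ ∩ X¹) + μ(O⁰ ∩ X¹)` for `X = A ∖ B` (uses that `B ∩ N` and `A ∩ B` are increasing, so no other petal and not the core can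
move into `X`). [this work] -/
theorem petal_section_true (hA : IsUpperSet A) (hB : IsUpperSet B) (hN : IsUpperSet N) (hBA : B \ A ⊆ N) :
    m⟦p, secAt e true (A \ B)⟧ =
      m⟦p, secAt e false (A \ B) ∩ secAt e true (A \ B)⟧ + m⟦p, secAt e false (A ∪ B)ᶜ ∩ secAt e true (A \ B)⟧ := by
  have e1 : ind (secAt e true (A \ B)) =
      ind (secAt e false (A \ B) ∩ secAt e true (A \ B)) + ind (secAt e false (A ∪ B)ᶜ ∩ secAt e true (A \ B)) := by
    funext ω
    simp only [Pi.add_apply]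
    by_cases h1 : ω ∈ secAt e true (A \ B)
    · rw [ind_of_mem h1]
      have h1' := h1; rw [mem_secAt] at h1'
      -- the level-0 configuration is not in `B` (else, `B` increasing, the level-1 one would be)
      have hB0 : forceAt e false ω ∉ B := fun hb => h1'.2 (by
        have := secAt_false_sub_true e hB (show ω ∈ secAt e false B by rw [mem_secAt]; exact hb)
        rw [mem_secAt] at this; exact this)
      by_cases hA0 : forceAt e false ω ∈ A
      · have hP0 : ω ∈ secAt e false (A \ B) := by rw [mem_secAt]; exact ⟨hA0, hB0⟩
        have hO0 : ω ∉ secAt e false (A ∪ B)ᶜ := by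
          rw [mem_secAt]; exact fun h => h (Or.inl hA0)
        rw [ind_of_mem (show ω ∈ secAt e false (A \ B) ∩ secAt e true (A \ B) from ⟨hP0, h1⟩),
          ind_of_not_mem (show ω ∉ secAt e false (A ∪ B)ᶜ ∩ secAt e true (A \ B) from fun h => hO0 h.1)]; norm_num
      · have hP0 : ω ∉ secAt e false (A \ B) := by rw [mem_secAt]; exact fun h => hA0 h.1
        have hO0 : ω ∈ secAt e false (A ∪ B)ᶜ := by
          rw [mem_secAt]; exact fun h => h.elim hA0 hB0
        rw [ind_of_not_mem (show ω ∉ secAt e false (A \ B) ∩ secAt e true (A \ B) from fun h => hP0 h.1),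
          ind_of_mem (show ω ∈ secAt e false (A ∪ B)ᶜ ∩ secAt e true (A \ B) from ⟨hO0, h1⟩)]; norm_num
    · rw [ind_of_not_mem h1, ind_of_not_mem (show ω ∉ secAt e false (A \ B) ∩ secAt e true (A \ B) from fun h => h1 h.2),
        ind_of_not_mem (show ω ∉ secAt e false (A ∪ B)ᶜ ∩ secAt e true (A \ B) from fun h => h1 h.2)]; norm_num
  have _ := hA; have _ := hN; have _ := hBA
  have h := congrArg (ex (bernoulliWeight p)) e1
  rwa [ex_add] at h

/-- **Bookkeeping for the petal `Dₙ = (A∩B)∖N`, level 0**: `μ(Dₙ⁰) = μ(Dₙ⁰ ∩ Dₙ¹) + μ(Dₙ⁰ ∩ K¹)`. [this work] -/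
theorem dpetal_section_false (hA : IsUpperSet A) (hB : IsUpperSet B) :
    m⟦p, secAt e false ((A ∩ B) \ N)⟧ =
      m⟦p, secAt e false ((A ∩ B) \ N) ∩ secAt e true ((A ∩ B) \ N)⟧ + m⟦p, secAt e false ((A ∩ B) \ N) ∩ secAt e true (A ∩ B ∩ N)⟧ := by
  have hAB' : IsUpperSet (A ∩ B) := hA.inter hB
  have e1 : ind (secAt e false ((A ∩ B) \ N)) =
      ind (secAt e false ((A ∩ B) \ N) ∩ secAt e true ((A ∩ B) \ N)) + ind (secAt e false ((A ∩ B) \ N) ∩ secAt e true (A ∩ B ∩ N)) := by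
    funext ω
    simp only [Pi.add_apply]
    by_cases h0 : ω ∈ secAt e false ((A ∩ B) \ N)
    · rw [ind_of_mem h0]
      have h0' := h0; rw [mem_secAt] at h0'
      have hC1 : ω ∈ secAt e true (A ∩ B) := secAt_false_sub_true e hAB' (show ω ∈ secAt e false (A ∩ B) by rw [mem_secAt]; exact h0'.1)
      rw [mem_secAt] at hC1
      by_cases hN1 : forceAt e true ω ∈ N
      · have hK : ω ∈ secAt e true (A ∩ B ∩ N) := by rw [mem_secAt]; exact ⟨hC1, hN1⟩
        have hD : ω ∉ secAt e true ((A ∩ B) \ N) := by rw [mem_secAt]; exact fun h => h.2 hN1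
        rw [ind_of_not_mem (show ω ∉ secAt e false ((A ∩ B) \ N) ∩ secAt e true ((A ∩ B) \ N) from fun h => hD h.2),
          ind_of_mem (show ω ∈ secAt e false ((A ∩ B) \ N) ∩ secAt e true (A ∩ B ∩ N) from ⟨h0, hK⟩)]; norm_num
      · have hD : ω ∈ secAt e true ((A ∩ B) \ N) := by rw [mem_secAt]; exact ⟨hC1, hN1⟩
        have hK : ω ∉ secAt e true (A ∩ B ∩ N) := by rw [mem_secAt]; exact fun h => hN1 h.2
        rw [ind_of_mem (show ω ∈ secAt e false ((A ∩ B) \ N) ∩ secAt e true ((A ∩ B) \ N) from ⟨h0, hD⟩),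
          ind_of_not_mem (show ω ∉ secAt e false ((A ∩ B) \ N) ∩ secAt e true (A ∩ B ∩ N) from fun h => hK h.2)]; norm_num
    · rw [ind_of_not_mem h0, ind_of_not_mem (show ω ∉ secAt e false ((A ∩ B) \ N) ∩ secAt e true ((A ∩ B) \ N) from fun h => h0 h.1),
        ind_of_not_mem (show ω ∉ secAt e false ((A ∩ B) \ N) ∩ secAt e true (A ∩ B ∩ N) from fun h => h0 h.1)]; norm_num
  have h := congrArg (ex (bernoulliWeight p)) e1
  rwa [ex_add] at h

/-- **Bookkeeping for `Dₙ`, level 1**: `μ(Dₙ¹) = μ(Dₙ⁰ ∩ Dₙ¹) + μ(O⁰ ∩ Dₙ¹)` (no petal `A∖B`, `B∖A` configuration can move into `Dₙ`, because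
`A ∩ N` and `B ∩ N` are increasing). [this work] -/
theorem dpetal_section_true (hA : IsUpperSet A) (hB : IsUpperSet B) (hN : IsUpperSet N) (hAB : A \ B ⊆ N) (hBA : B \ A ⊆ N) :
    m⟦p, secAt e true ((A ∩ B) \ N)⟧ =
      m⟦p, secAt e false ((A ∩ B) \ N) ∩ secAt e true ((A ∩ B) \ N)⟧ + m⟦p, secAt e false (A ∪ B)ᶜ ∩ secAt e true ((A ∩ B) \ N)⟧ := by
  have hAN : IsUpperSet (A ∩ N) := hA.inter hN
  have hBN : IsUpperSet (B ∩ N) := hB.inter hN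
  have e1 : ind (secAt e true ((A ∩ B) \ N)) =
      ind (secAt e false ((A ∩ B) \ N) ∩ secAt e true ((A ∩ B) \ N)) + ind (secAt e false (A ∪ B)ᶜ ∩ secAt e true ((A ∩ B) \ N)) := by
    funext ω
    simp only [Pi.add_apply]
    by_cases h1 : ω ∈ secAt e true ((A ∩ B) \ N)
    · rw [ind_of_mem h1]
      have h1' := h1; rw [mem_secAt] at h1'
      -- the level-0 configuration is not in `N` (N increasing), hence neither in `A ∖ B` nor in `B ∖ A` (both inside `N`)
      have hN0 : forceAt e false ω ∉ N := fun hn => h1'.2 (by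
        have := secAt_false_sub_true e hN (show ω ∈ secAt e false N by rw [mem_secAt]; exact hn)
        rw [mem_secAt] at this; exact this)
      by_cases hA0 : forceAt e false ω ∈ A
      · have hB0 : forceAt e false ω ∈ B := by
          by_contra hb; exact hN0 (hAB ⟨hA0, hb⟩)
        have hD0 : ω ∈ secAt e false ((A ∩ B) \ N) := by rw [mem_secAt]; exact ⟨⟨hA0, hB0⟩, hN0⟩
        have hO0 : ω ∉ secAt e false (A ∪ B)ᶜ := by rw [mem_secAt]; exact fun h => h (Or.inl hA0)
        rw [ind_of_mem (show ω ∈ secAt e false ((A ∩ B) \ N) ∩ secAt e true ((A ∩ B) \ N) from ⟨hD0, h1⟩),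
          ind_of_not_mem (show ω ∉ secAt e false (A ∪ B)ᶜ ∩ secAt e true ((A ∩ B) \ N) from fun h => hO0 h.1)]; norm_num
      · have hB0 : forceAt e false ω ∉ B := fun hb => hN0 (hBA ⟨hb, hA0⟩)
        have hD0 : ω ∉ secAt e false ((A ∩ B) \ N) := by rw [mem_secAt]; exact fun h => hA0 h.1.1
        have hO0 : ω ∈ secAt e false (A ∪ B)ᶜ := by rw [mem_secAt]; exact fun h => h.elim hA0 hB0
        rw [ind_of_not_mem (show ω ∉ secAt e false ((A ∩ B) \ N) ∩ secAt e true ((A ∩ B) \ N) from fun h => hD0 h.1),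
          ind_of_mem (show ω ∈ secAt e false (A ∪ B)ᶜ ∩ secAt e true ((A ∩ B) \ N) from ⟨hO0, h1⟩)]; norm_num
    · rw [ind_of_not_mem h1, ind_of_not_mem (show ω ∉ secAt e false ((A ∩ B) \ N) ∩ secAt e true ((A ∩ B) \ N) from fun h => h1 h.2),
        ind_of_not_mem (show ω ∉ secAt e false (A ∪ B)ᶜ ∩ secAt e true ((A ∩ B) \ N) from fun h => h1 h.2)]; norm_num
  have _ := hAN; have _ := hBN
  have h := congrArg (ex (bernoulliWeight p)) e1
  rwa [ex_add] at h

/-- **Core bookkeeping**: `μ(K¹) = μ(K⁰) + cp_P + cp_Q + cp_D + d` — a level-`1` core configuration comes from the core, a petal or outside. [this work] -/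
theorem core_section_true (hA : IsUpperSet A) (hB : IsUpperSet B) (hN : IsUpperSet N) :
    m⟦p, secAt e true (A ∩ B ∩ N)⟧ =
      m⟦p, secAt e false (A ∩ B ∩ N)⟧ + m⟦p, secAt e false (A \ B) ∩ secAt e true (A ∩ B ∩ N)⟧
        + m⟦p, secAt e false (B \ A) ∩ secAt e true (A ∩ B ∩ N)⟧ + m⟦p, secAt e false ((A ∩ B) \ N) ∩ secAt e true (A ∩ B ∩ N)⟧
        + m⟦p, secAt e false (A ∪ B)ᶜ ∩ secAt e true (A ∩ B ∩ N)⟧ := by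
  have hK : IsUpperSet (A ∩ B ∩ N) := (hA.inter hB).inter hN
  have e1 : ind (secAt e true (A ∩ B ∩ N)) =
      ind (secAt e false (A ∩ B ∩ N)) + ind (secAt e false (A \ B) ∩ secAt e true (A ∩ B ∩ N))
        + ind (secAt e false (B \ A) ∩ secAt e true (A ∩ B ∩ N)) + ind (secAt e false ((A ∩ B) \ N) ∩ secAt e true (A ∩ B ∩ N))
        + ind (secAt e false (A ∪ B)ᶜ ∩ secAt e true (A ∩ B ∩ N)) := by
    funext ω
    simp only [Pi.add_apply]
    by_cases h1 : ω ∈ secAt e true (A ∩ B ∩ N)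
    · rw [ind_of_mem h1]
      by_cases hK0 : ω ∈ secAt e false (A ∩ B ∩ N)
      · have hK0' := hK0; rw [mem_secAt] at hK0'
        rw [ind_of_mem hK0,
          ind_of_not_mem (show ω ∉ secAt e false (A \ B) ∩ secAt e true (A ∩ B ∩ N) from fun h => by
            have := h.1; rw [mem_secAt] at this; exact this.2 hK0'.1.2),
          ind_of_not_mem (show ω ∉ secAt e false (B \ A) ∩ secAt e true (A ∩ B ∩ N) from fun h => by
            have := h.1; rw [mem_secAt] at this; exact this.2 hK0'.1.1),
          ind_of_not_mem (show ω ∉ secAt e false ((A ∩ B) \ N) ∩ secAt e true (A ∩ B ∩ N) from fun h => by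
            have := h.1; rw [mem_secAt] at this; exact this.2 hK0'.2),
          ind_of_not_mem (show ω ∉ secAt e false (A ∪ B)ᶜ ∩ secAt e true (A ∩ B ∩ N) from fun h => by
            have := h.1; rw [mem_secAt] at this; exact this (Or.inl hK0'.1.1))]
        norm_num
      · rw [ind_of_not_mem hK0]
        have hK0' : ¬ (forceAt e false ω ∈ A ∩ B ∩ N) := fun h => hK0 (by rw [mem_secAt]; exact h)
        by_cases hA0 : forceAt e false ω ∈ A <;> by_cases hB0 : forceAt e false ω ∈ B
        · have hN0 : forceAt e false ω ∉ N := fun hn => hK0' ⟨⟨hA0, hB0⟩, hn⟩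
          rw [ind_of_not_mem (show ω ∉ secAt e false (A \ B) ∩ secAt e true (A ∩ B ∩ N) from fun h => by
              have := h.1; rw [mem_secAt] at this; exact this.2 hB0),
            ind_of_not_mem (show ω ∉ secAt e false (B \ A) ∩ secAt e true (A ∩ B ∩ N) from fun h => by
              have := h.1; rw [mem_secAt] at this; exact this.2 hA0),
            ind_of_mem (show ω ∈ secAt e false ((A ∩ B) \ N) ∩ secAt e true (A ∩ B ∩ N) from
              ⟨by rw [mem_secAt]; exact ⟨⟨hA0, hB0⟩, hN0⟩, h1⟩),
            ind_of_not_mem (show ω ∉ secAt e false (A ∪ B)ᶜ ∩ secAt e true (A ∩ B ∩ N) from fun h => by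
              have := h.1; rw [mem_secAt] at this; exact this (Or.inl hA0))]
          norm_num
        · rw [ind_of_mem (show ω ∈ secAt e false (A \ B) ∩ secAt e true (A ∩ B ∩ N) from ⟨by rw [mem_secAt]; exact ⟨hA0, hB0⟩, h1⟩),
            ind_of_not_mem (show ω ∉ secAt e false (B \ A) ∩ secAt e true (A ∩ B ∩ N) from fun h => by
              have := h.1; rw [mem_secAt] at this; exact this.2 hA0),
            ind_of_not_mem (show ω ∉ secAt e false ((A ∩ B) \ N) ∩ secAt e true (A ∩ B ∩ N) from fun h => by
              have := h.1; rw [mem_secAt] at this; exact hB0 this.1.2),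
            ind_of_not_mem (show ω ∉ secAt e false (A ∪ B)ᶜ ∩ secAt e true (A ∩ B ∩ N) from fun h => by
              have := h.1; rw [mem_secAt] at this; exact this (Or.inl hA0))]
          norm_num
        · rw [ind_of_not_mem (show ω ∉ secAt e false (A \ B) ∩ secAt e true (A ∩ B ∩ N) from fun h => by
              have := h.1; rw [mem_secAt] at this; exact hA0 this.1),
            ind_of_mem (show ω ∈ secAt e false (B \ A) ∩ secAt e true (A ∩ B ∩ N) from ⟨by rw [mem_secAt]; exact ⟨hB0, hA0⟩, h1⟩),
            ind_of_not_mem (show ω ∉ secAt e false ((A ∩ B) \ N) ∩ secAt e true (A ∩ B ∩ N) from fun h => by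
              have := h.1; rw [mem_secAt] at this; exact hA0 this.1.1),
            ind_of_not_mem (show ω ∉ secAt e false (A ∪ B)ᶜ ∩ secAt e true (A ∩ B ∩ N) from fun h => by
              have := h.1; rw [mem_secAt] at this; exact this (Or.inr hB0))]
          norm_num
        · rw [ind_of_not_mem (show ω ∉ secAt e false (A \ B) ∩ secAt e true (A ∩ B ∩ N) from fun h => by
              have := h.1; rw [mem_secAt] at this; exact hA0 this.1),
            ind_of_not_mem (show ω ∉ secAt e false (B \ A) ∩ secAt e true (A ∩ B ∩ N) from fun h => by
              have := h.1; rw [mem_secAt] at this; exact hB0 this.1),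
            ind_of_not_mem (show ω ∉ secAt e false ((A ∩ B) \ N) ∩ secAt e true (A ∩ B ∩ N) from fun h => by
              have := h.1; rw [mem_secAt] at this; exact hA0 this.1.1),
            ind_of_mem (show ω ∈ secAt e false (A ∪ B)ᶜ ∩ secAt e true (A ∩ B ∩ N) from
              ⟨by rw [mem_secAt]; exact fun h => h.elim hA0 hB0, h1⟩)]
          norm_num
    · have hK0 : ω ∉ secAt e false (A ∩ B ∩ N) := fun h => h1 (secAt_false_sub_true e hK h)
      rw [ind_of_not_mem h1, ind_of_not_mem hK0,
        ind_of_not_mem (show ω ∉ secAt e false (A \ B) ∩ secAt e true (A ∩ B ∩ N) from fun h => h1 h.2),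
        ind_of_not_mem (show ω ∉ secAt e false (B \ A) ∩ secAt e true (A ∩ B ∩ N) from fun h => h1 h.2),
        ind_of_not_mem (show ω ∉ secAt e false ((A ∩ B) \ N) ∩ secAt e true (A ∩ B ∩ N) from fun h => h1 h.2),
        ind_of_not_mem (show ω ∉ secAt e false (A ∪ B)ᶜ ∩ secAt e true (A ∩ B ∩ N) from fun h => h1 h.2)]
      norm_num
  have h := congrArg (ex (bernoulliWeight p)) e1
  rw [ex_add, ex_add, ex_add, ex_add] at h
  exact h

/-- **Outside bookkeeping**: `μ(O⁰) = μ(O¹) + cm_P + cm_Q + cm_D + d` — a level-`0` outside configuration may move anywhere. [this work] -/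
theorem outside_section_false (hA : IsUpperSet A) (hB : IsUpperSet B) :
    m⟦p, secAt e false (A ∪ B)ᶜ⟧ =
      m⟦p, secAt e true (A ∪ B)ᶜ⟧ + m⟦p, secAt e false (A ∪ B)ᶜ ∩ secAt e true (A \ B)⟧
        + m⟦p, secAt e false (A ∪ B)ᶜ ∩ secAt e true (B \ A)⟧ + m⟦p, secAt e false (A ∪ B)ᶜ ∩ secAt e true ((A ∩ B) \ N)⟧
        + m⟦p, secAt e false (A ∪ B)ᶜ ∩ secAt e true (A ∩ B ∩ N)⟧ := by
  have hW : IsUpperSet (A ∪ B) := hA.union hB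
  have e1 : ind (secAt e false (A ∪ B)ᶜ) =
      ind (secAt e true (A ∪ B)ᶜ) + ind (secAt e false (A ∪ B)ᶜ ∩ secAt e true (A \ B))
        + ind (secAt e false (A ∪ B)ᶜ ∩ secAt e true (B \ A)) + ind (secAt e false (A ∪ B)ᶜ ∩ secAt e true ((A ∩ B) \ N))
        + ind (secAt e false (A ∪ B)ᶜ ∩ secAt e true (A ∩ B ∩ N)) := by
    funext ω
    simp only [Pi.add_apply]
    by_cases h0 : ω ∈ secAt e false (A ∪ B)ᶜ
    · by_cases hO1 : ω ∈ secAt e true (A ∪ B)ᶜ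
      · have hO1' : forceAt e true ω ∉ A ∪ B := by rw [mem_secAt] at hO1; exact hO1
        rw [ind_of_mem h0, ind_of_mem hO1,
          ind_of_not_mem (show ω ∉ secAt e false (A ∪ B)ᶜ ∩ secAt e true (A \ B) from fun h => by
            have := h.2; rw [mem_secAt] at this; exact hO1' (Or.inl this.1)),
          ind_of_not_mem (show ω ∉ secAt e false (A ∪ B)ᶜ ∩ secAt e true (B \ A) from fun h => by
            have := h.2; rw [mem_secAt] at this; exact hO1' (Or.inr this.1)),
          ind_of_not_mem (show ω ∉ secAt e false (A ∪ B)ᶜ ∩ secAt e true ((A ∩ B) \ N) from fun h => by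
            have := h.2; rw [mem_secAt] at this; exact hO1' (Or.inl this.1.1)),
          ind_of_not_mem (show ω ∉ secAt e false (A ∪ B)ᶜ ∩ secAt e true (A ∩ B ∩ N) from fun h => by
            have := h.2; rw [mem_secAt] at this; exact hO1' (Or.inl this.1.1))]
        norm_num
      · rw [ind_of_mem h0, ind_of_not_mem hO1]
        have hW1 : forceAt e true ω ∈ A ∪ B := by
          by_contra h; exact hO1 (by rw [mem_secAt]; exact h)
        by_cases hA1 : forceAt e true ω ∈ A <;> by_cases hB1 : forceAt e true ω ∈ B
        · by_cases hN1 : forceAt e true ω ∈ N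
          · rw [ind_of_not_mem (show ω ∉ secAt e false (A ∪ B)ᶜ ∩ secAt e true (A \ B) from fun h => by
                have := h.2; rw [mem_secAt] at this; exact this.2 hB1),
              ind_of_not_mem (show ω ∉ secAt e false (A ∪ B)ᶜ ∩ secAt e true (B \ A) from fun h => by
                have := h.2; rw [mem_secAt] at this; exact this.2 hA1),
              ind_of_not_mem (show ω ∉ secAt e false (A ∪ B)ᶜ ∩ secAt e true ((A ∩ B) \ N) from fun h => by
                have := h.2; rw [mem_secAt] at this; exact this.2 hN1),
              ind_of_mem (show ω ∈ secAt e false (A ∪ B)ᶜ ∩ secAt e true (A ∩ B ∩ N) from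
                ⟨h0, by rw [mem_secAt]; exact ⟨⟨hA1, hB1⟩, hN1⟩⟩)]
            norm_num
          · rw [ind_of_not_mem (show ω ∉ secAt e false (A ∪ B)ᶜ ∩ secAt e true (A \ B) from fun h => by
                have := h.2; rw [mem_secAt] at this; exact this.2 hB1),
              ind_of_not_mem (show ω ∉ secAt e false (A ∪ B)ᶜ ∩ secAt e true (B \ A) from fun h => by
                have := h.2; rw [mem_secAt] at this; exact this.2 hA1),
              ind_of_mem (show ω ∈ secAt e false (A ∪ B)ᶜ ∩ secAt e true ((A ∩ B) \ N) from
                ⟨h0, by rw [mem_secAt]; exact ⟨⟨hA1, hB1⟩, hN1⟩⟩),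
              ind_of_not_mem (show ω ∉ secAt e false (A ∪ B)ᶜ ∩ secAt e true (A ∩ B ∩ N) from fun h => by
                have := h.2; rw [mem_secAt] at this; exact hN1 this.2)]
            norm_num
        · rw [ind_of_mem (show ω ∈ secAt e false (A ∪ B)ᶜ ∩ secAt e true (A \ B) from ⟨h0, by rw [mem_secAt]; exact ⟨hA1, hB1⟩⟩),
            ind_of_not_mem (show ω ∉ secAt e false (A ∪ B)ᶜ ∩ secAt e true (B \ A) from fun h => by
              have := h.2; rw [mem_secAt] at this; exact this.2 hA1),
            ind_of_not_mem (show ω ∉ secAt e false (A ∪ B)ᶜ ∩ secAt e true ((A ∩ B) \ N) from fun h => by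
              have := h.2; rw [mem_secAt] at this; exact hB1 this.1.2),
            ind_of_not_mem (show ω ∉ secAt e false (A ∪ B)ᶜ ∩ secAt e true (A ∩ B ∩ N) from fun h => by
              have := h.2; rw [mem_secAt] at this; exact hB1 this.1.2)]
          norm_num
        · rw [ind_of_not_mem (show ω ∉ secAt e false (A ∪ B)ᶜ ∩ secAt e true (A \ B) from fun h => by
              have := h.2; rw [mem_secAt] at this; exact hA1 this.1),
            ind_of_mem (show ω ∈ secAt e false (A ∪ B)ᶜ ∩ secAt e true (B \ A) from ⟨h0, by rw [mem_secAt]; exact ⟨hB1, hA1⟩⟩),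
            ind_of_not_mem (show ω ∉ secAt e false (A ∪ B)ᶜ ∩ secAt e true ((A ∩ B) \ N) from fun h => by
              have := h.2; rw [mem_secAt] at this; exact hA1 this.1.1),
            ind_of_not_mem (show ω ∉ secAt e false (A ∪ B)ᶜ ∩ secAt e true (A ∩ B ∩ N) from fun h => by
              have := h.2; rw [mem_secAt] at this; exact hA1 this.1.1)]
          norm_num
        · exact absurd hW1 (fun h => h.elim hA1 hB1)
    · have hO1 : ω ∉ secAt e true (A ∪ B)ᶜ := fun h => h0 (secAt_true_compl_sub e hW h)
      rw [ind_of_not_mem h0, ind_of_not_mem hO1,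
        ind_of_not_mem (show ω ∉ secAt e false (A ∪ B)ᶜ ∩ secAt e true (A \ B) from fun h => h0 h.1),
        ind_of_not_mem (show ω ∉ secAt e false (A ∪ B)ᶜ ∩ secAt e true (B \ A) from fun h => h0 h.1),
        ind_of_not_mem (show ω ∉ secAt e false (A ∪ B)ᶜ ∩ secAt e true ((A ∩ B) \ N) from fun h => h0 h.1),
        ind_of_not_mem (show ω ∉ secAt e false (A ∪ B)ᶜ ∩ secAt e true (A ∩ B ∩ N) from fun h => h0 h.1)]
      norm_num
  have h := congrArg (ex (bernoulliWeight p)) e1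
  rw [ex_add, ex_add, ex_add, ex_add] at h
  exact h

end Bookkeeping


end SahiDeepCore

end Summit.CriticalPhenomena.PercolationContinuityZ3.Theorems
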